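import Literature.Topology.FourManifolds.SurfaceGroupCoveringSpan
import Mathlib.LinearAlgebra.Dimension.Localization
import Mathlib.LinearAlgebra.FreeModule.StrongRankCondition
import Mathlib.RingTheory.Noetherian.Basic
import HarnessLib

/-!
# Finite-index subgroups of surface groups, III: the degree of the covering is `±` the index

Topic `Literature/Topology/FourManifolds`; theorems only; continuation of `SurfaceGroupCoveringLifts.lean`
and `SurfaceGroupCoveringSpan.lean` (notation `F`, `R = ker proj_g`, `K ≤ S_g` of index `n`,
`E = proj⁻¹ K`, `π_E : E ↠ K`, `N = ker π_E`, `C = [E, N]`, transversal `u`, complete list `l` of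
`F/E`, `ρ = ∏_{q ∈ l} u_q⁻¹ r_g u_q ∈ N`, lifts `θ : F_h → E`, `θ' : E → F_h` of an isomorphism
`e : K ≅ S_h` and its inverse).

**Theorem** (`lift_surfaceRelator_inv_mul_prod_zpow_mem`, the DEGREE of the "covering" `K → S_g`):
if `E` is free of rank `n (2g - 1) + 1` (Schreier; supplied as a free basis `ι` of `E` with
`|ι| + n = 2 g n + 1`, `SchreierIndexFormula.lean`) and `h = n (g - 1) + 1` (Riemann–Hurwitz,
supplied as `h + n = n g + 1`; under the tree's fact `SurfaceGroupFiniteIndexSubgroup` this is the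
genus of `K`), then

  `θ(r_h) ≡ ρ^{ε} (mod C)`, `ε = ±1`.

In Hopf's terms (`H₂(K) = (N ∩ [E,E])/[E,N]`): the transfer of the fundamental class `[r_g]` is
`± θ_*[r_h]`, i.e. the covering `K → S_g` has degree `± n` — K. S. Brown, *Cohomology of Groups*,
II §5 (Hopf's formula), III (9.5)(ii) (`cor ∘ res = n`), VIII §2 (surface groups are `PD²`).  The proof
here is the algebraic RANK COUNT (Euler characteristic): in `L = ℤ^{F/E}` consider `Λ(c) = Σ c_q [u_q⁻¹
r_g u_q] ∈ H₁(E)`; its image is the image of `N` (`SurfaceGroupCoveringSpan`), of corank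
`rank H₁(K) = 2h`, and `rank H₁(E) = |ι|`, so `rank ker Λ = n - (|ι| - 2h) = 1`; the TRANSFER gives
`𝟙 ∈ ker Λ` (`ρ ∈ [E,E]`); the class of `θ(r_h)` modulo `C` has a coefficient vector `s ∈ ker Λ`
(generation modulo `C`, `SurfaceGroupCoveringSpan`), hence `s = k 𝟙` and `θ(r_h) ≡ ρ^k`; finally
HOPF (`θ'θ(r_h) ≡ r_h mod [F_h, R_h]`, `HopfLiftLemmas`) and Zieschang's degree form `relatorDegree`
on `R_h` (ZVC LNM 835, 5.5.1; tree `SurfaceGroupNielsenDegreeForm.lean`) force `k m = 1` where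
`θ'(ρ) ≡ r_h^m`, so `k = ±1`.  No definitions; classical; nothing here concerns any disputed claim.
-/

noncomputable section

open scoped IsMulCommutative

namespace Literature.Topology.FourManifolds

namespace SurfaceGroup

open Literature.GroupTheory.CombinatorialGroupTheory Subgroup Module
open scoped commutatorElement

variable {g h : ℕ}

/-! ### More on Zieschang's degree form on the relation subgroup -/

/-- The degree of `x^k` (`x ∈ R`) is `k` times the degree. [cite: ZieschangVogtColdewey1980, 5.5.1] -/
theorem relatorDegree_zpow_of_mem_ker {x : FreeGroup (surfaceGen g)} (hx : x ∈ (proj g).ker) (k : ℤ) :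
    relatorDegree g (x ^ k) = k * relatorDegree g x := by
  induction k using Int.induction_on with
  | zero =>
    simp only [zpow_zero, zero_mul]
    unfold relatorDegree omega
    rw [map_one, Heis.one_c]
  | succ n ih =>
    rw [zpow_add_one, relatorDegree_mul_of_mem_ker ((proj g).ker.zpow_mem hx n), ih]
    ring
  | pred n ih =>
    rw [zpow_sub_one, relatorDegree_mul_of_mem_ker ((proj g).ker.zpow_mem hx _), ih,
      relatorDegree_inv_of_mem_ker hx]
    ring

/-- The degree form vanishes on `[F, R] = ⁅⊤, ker proj⁆` (it is conjugation invariant and additive on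
`R`). [cite: ZieschangVogtColdewey1980, 5.5.1] -/
theorem relatorDegree_eq_zero_of_mem_commutator_ker {x : FreeGroup (surfaceGen g)}
    (hx : x ∈ ⁅(⊤ : Subgroup (FreeGroup (surfaceGen g))), (proj g).ker⁆) :
    x ∈ (proj g).ker ∧ relatorDegree g x = 0 := by
  rw [Subgroup.commutator_def] at hx
  induction hx using Subgroup.closure_induction with
  | mem y hy =>
    obtain ⟨a, -, b, hb, rfl⟩ := hy
    have hab : a * b * a⁻¹ ∈ (proj g).ker := (MonoidHom.normal_ker (proj g)).conj_mem b hb a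
    refine ⟨?_, ?_⟩
    · rw [commutatorElement_def]
      exact (proj g).ker.mul_mem hab ((proj g).ker.inv_mem hb)
    · rw [commutatorElement_def, relatorDegree_mul_of_mem_ker hab, relatorDegree_conj_of_mem_ker a hb,
        relatorDegree_inv_of_mem_ker hb, add_neg_cancel]
  | one =>
    refine ⟨one_mem _, ?_⟩
    unfold relatorDegree omega
    rw [map_one, Heis.one_c]
  | mul y z _ _ hy hz =>
    exact ⟨mul_mem hy.1 hz.1, by rw [relatorDegree_mul_of_mem_ker hy.1, hy.2, hz.2, add_zero]⟩
  | inv y _ hy =>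
    exact ⟨inv_mem hy.1, by rw [relatorDegree_inv_of_mem_ker hy.1, hy.2, neg_zero]⟩

/-- If `r_h⁻¹ r_h^{j}` lies in `[F_h, R_h]` and `h ≥ 1` then `j = 1` (degrees: `(j - 1) h = 0`).
[cite: ZieschangVogtColdewey1980, 5.5.1] -/
theorem zpow_eq_one_of_mem_commutator_ker (hh : 1 ≤ h) {j : ℤ}
    (hj : (surfaceRelator h)⁻¹ * surfaceRelator h ^ j ∈
      ⁅(⊤ : Subgroup (FreeGroup (surfaceGen h))), (proj h).ker⁆) : j = 1 := by
  have h0 := (relatorDegree_eq_zero_of_mem_commutator_ker hj).2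
  have hr : surfaceRelator h ∈ (proj h).ker := surfaceRelator_mem_ker_proj
  rw [relatorDegree_mul_of_mem_ker ((proj h).ker.inv_mem hr), relatorDegree_inv_of_mem_ker hr,
    relatorDegree_zpow_of_mem_ker hr, relatorDegree_surfaceRelator] at h0
  have h1 : ((j - 1) : ℤ) * (h : ℤ) = 0 := by linarith
  rcases mul_eq_zero.mp h1 with h2 | h2
  · linarith
  · exfalso; exact absurd (by exact_mod_cast h2 : h = 0) (by omega)

/-! ### The degree theorem -/

set_option maxHeartbeats 400000 in
/-- **The degree of a finite covering of surface groups is `±` the index** (rank-count form).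
With the notation of the module docstring and the hypotheses: `1 ≤ g`; `θ, θ'` lifts of `e⁻¹ : S_h → K`
and `e`; `u` a transversal of `F/E` with complete duplicate-free list `l` of cosets; a free basis `ι` of
`E` with `|ι| + n = n · 2g + 1` (Schreier); and `h + n = n g + 1` (Riemann–Hurwitz).  Then for some
`ε = ±1`, `θ(r_h)⁻¹ · (∏_{q ∈ l} u_q⁻¹ r_g u_q)^{ε}` lies in `C = [E, N]`.
[cite: Brown1982CohomologyGroups, III (9.5)(ii)] -/
theorem lift_surfaceRelator_inv_mul_prod_zpow_mem (hg : 1 ≤ g) (K : Subgroup (SurfaceGroup g))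
    [K.FiniteIndex] (e : K ≃* SurfaceGroup h)
    (θ : FreeGroup (surfaceGen h) →* K.comap (proj g))
    (hθ : ∀ x, (proj g).subgroupComap K (θ x) = e.symm (proj h x))
    (θ' : K.comap (proj g) →* FreeGroup (surfaceGen h))
    (hθ' : ∀ y, proj h (θ' y) = e ((proj g).subgroupComap K y))
    (u : FreeGroup (surfaceGen g) ⧸ K.comap (proj g) → FreeGroup (surfaceGen g))
    (hu : ∀ q, (u q : FreeGroup (surfaceGen g) ⧸ K.comap (proj g)) = q)
    (l : List (FreeGroup (surfaceGen g) ⧸ K.comap (proj g))) (hl : ∀ q, q ∈ l) (hnd : l.Nodup)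
    {ι : Type} [Finite ι] (bE : FreeGroupBasis ι (K.comap (proj g)))
    (hι : Nat.card ι + K.index = K.index * (2 * g) + 1) (hh : h + K.index = K.index * g + 1) :
    ∃ ε : ℤ, (ε = 1 ∨ ε = -1) ∧
      (θ (surfaceRelator h))⁻¹ *
          (l.map fun q => (⟨(u q)⁻¹ * surfaceRelator g * u q, conj_relator_mem_comap K (u q)⟩ :
            K.comap (proj g))).prod ^ ε ∈
        ⁅(⊤ : Subgroup (K.comap (proj g))), ((proj g).subgroupComap K).ker⁆ := by
  classical
  -- finiteness of the coset space; `n`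
  haveI hEfi : (K.comap (proj g)).FiniteIndex :=
    ⟨by rw [index_comap_proj]; exact FiniteIndex.index_ne_zero⟩
  haveI : Finite (FreeGroup (surfaceGen g) ⧸ K.comap (proj g)) := finite_quotient_of_finiteIndex
  letI : Fintype (FreeGroup (surfaceGen g) ⧸ K.comap (proj g)) := Fintype.ofFinite _
  set n := K.index with hndef
  have hn : Fintype.card (FreeGroup (surfaceGen g) ⧸ K.comap (proj g)) = n := by
    rw [← Nat.card_eq_fintype_card, hndef, ← index_comap_proj K]; rfl
  have hn0 : 0 < n := Nat.pos_of_ne_zero FiniteIndex.index_ne_zero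
  have hh1 : 1 ≤ h := by
    have : n ≤ n * g := Nat.le_mul_of_pos_right n hg
    omega
  -- names
  set N := ((proj g).subgroupComap K).ker with hNdef
  set rE : FreeGroup (surfaceGen g) ⧸ K.comap (proj g) → K.comap (proj g) := fun q =>
    ⟨(u q)⁻¹ * surfaceRelator g * u q, conj_relator_mem_comap K (u q)⟩ with hrE
  set ρ := (l.map rE).prod with hρ
  set x := θ (surfaceRelator h) with hxdef
  have hxN : x ∈ N := lift_surfaceRelator_mem_ker K e θ hθ
  have hxcomm : x ∈ commutator (K.comap (proj g)) := lift_surfaceRelator_mem_commutator K θ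
  have hρN : ρ ∈ N := prod_conj_relator_mem_ker K u l
  have hρcomm : ρ ∈ commutator (K.comap (proj g)) := prod_conj_relator_mem_commutator K u hu l hl hnd
  -- the `ℤ`-modules `V = H₁(E)` and `L = ℤ^{F/E}`, the map `Λ`
  obtain ⟨hVrank, hVfin⟩ := finrank_additive_abelianization_eq_card bE
  haveI := hVfin
  obtain ⟨hKrank, hKfin⟩ := finrank_additive_abelianization_of_mulEquiv e
  haveI := hKfin
  let v : FreeGroup (surfaceGen g) ⧸ K.comap (proj g) → Additive (Abelianization (K.comap (proj g))) :=
    fun q => Additive.ofMul (Abelianization.of (rE q))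
  let Λ := Fintype.linearCombination ℤ v
  have hΛapply : ∀ c, Λ c = ∑ q, c q • v q := fun c => Fintype.linearCombination_apply ℤ v c
  -- `range Λ` = image of `N`; its corank is `rank H₁(K) = 2h`
  have hrange : LinearMap.range Λ =
      Submodule.span ℤ ((fun y : K.comap (proj g) => Additive.ofMul (Abelianization.of y)) ''
        (N : Set (K.comap (proj g)))) := by
    rw [Fintype.range_linearCombination, hNdef, span_image_ker_eq_span_range K u hu]
  obtain ⟨eQ⟩ := nonempty_abelianization_quotient_linearEquiv ((proj g).subgroupComap K)
    (MonoidHom.subgroupComap_surjective_of_surjective _ _ (QuotientGroup.mk'_surjective _))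
  have h2 := Submodule.finrank_quotient_add_finrank (LinearMap.range Λ)
  rw [((Submodule.quotEquivOfEq _ _ hrange).trans eQ).finrank_eq, hKrank, hVrank] at h2
  have h3 := Submodule.finrank_quotient_add_finrank (LinearMap.ker Λ)
  rw [Λ.quotKerEquivRange.finrank_eq, Module.finrank_fintype_fun_eq_card, hn] at h3
  have hker1 : finrank ℤ (LinearMap.ker Λ) = 1 := by
    have e2g : n * (2 * g) = 2 * (n * g) := by ring
    rw [e2g] at hι
    omega
  -- the transfer: `𝟙 ∈ ker Λ`
  have hperm : l.Perm (Finset.univ : Finset (FreeGroup (surfaceGen g) ⧸ K.comap (proj g))).toList :=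
    List.perm_of_nodup_nodup_toFinset_eq hnd (Finset.nodup_toList _)
      (by rw [Finset.toList_toFinset]; exact Finset.eq_univ_iff_forall.mpr fun q => by simp [hl q])
  have hsumv : ∑ q, v q = 0 := by
    have e1 : ∑ q, v q = (l.map v).sum := by
      rw [(hperm.map v).sum_eq, Finset.sum_map_toList]
    have e2 : (l.map v).sum = Additive.ofMul (Abelianization.of ρ) := by
      rw [hρ, map_list_prod, ofMul_list_prod, List.map_map, List.map_map]; rfl
    rw [e1, e2, ofMul_eq_zero, ← MonoidHom.mem_ker, Abelianization.ker_of]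
    exact hρcomm
  have hone : Λ (fun _ => (1 : ℤ)) = 0 := by
    rw [hΛapply]; simp only [one_smul]; exact hsumv
  -- the class of `x = θ(r_h)` modulo `C`: coefficient vector `s`
  have hxc := QuotientGroup.mk_mem_center_of_mem N hxN
  obtain ⟨s, hs⟩ := (Submodule.mem_span_range_iff_exists_fun ℤ).mp (ofMul_mk_mem_span K u hu hxN hxc)
  -- the map `f : Additive (center (E/C)) → H₁(E)` and `Λ s = 0`
  have hC : ⁅(⊤ : Subgroup (K.comap (proj g))), N⁆ ≤ (Abelianization.of (G := K.comap (proj g))).ker := by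
    rw [Abelianization.ker_of, _root_.commutator_def]
    exact Subgroup.commutator_mono le_rfl le_top
  let φ : Subgroup.center (K.comap (proj g) ⧸ ⁅(⊤ : Subgroup (K.comap (proj g))), N⁆) →*
      Abelianization (K.comap (proj g)) :=
    (QuotientGroup.lift _ Abelianization.of hC).comp (Subgroup.subtype _)
  let f := (MonoidHom.toAdditive φ).toIntLinearMap
  set wc : FreeGroup (surfaceGen g) ⧸ K.comap (proj g) → Subgroup.center
      (K.comap (proj g) ⧸ ⁅(⊤ : Subgroup (K.comap (proj g))), N⁆) := fun q =>
    ⟨QuotientGroup.mk (rE q), QuotientGroup.mk_mem_center_of_mem N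
      (conj_relator_mem_ker_subgroupComap K (u q))⟩ with hwc
  have hs' : ∑ q, s q • Additive.ofMul (wc q) =
      Additive.ofMul (⟨QuotientGroup.mk x, hxc⟩ : Subgroup.center _) := hs
  have hfw : ∀ q, f (Additive.ofMul (wc q)) = v q := by
    intro q
    change Additive.ofMul (φ (wc q)) = v q
    simp only [hwc, φ, MonoidHom.coe_comp, Function.comp_apply, Subgroup.coe_subtype]
    rw [QuotientGroup.lift_mk]
  have hfx : f (Additive.ofMul (⟨QuotientGroup.mk x, hxc⟩ : Subgroup.center _)) = 0 := by
    change Additive.ofMul (φ ⟨QuotientGroup.mk x, hxc⟩) = 0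
    simp only [φ, MonoidHom.coe_comp, Function.comp_apply, Subgroup.coe_subtype]
    rw [QuotientGroup.lift_mk, ofMul_eq_zero, ← MonoidHom.mem_ker, Abelianization.ker_of]
    exact hxcomm
  have hsker : Λ s = 0 := by
    rw [hΛapply]
    have : ∑ q, s q • v q = f (∑ q, s q • Additive.ofMul (wc q)) := by
      rw [map_sum]
      refine Finset.sum_congr rfl fun q _ => ?_
      rw [map_zsmul, hfw]
    rw [this, hs', hfx]
  -- `ker Λ` has rank one and contains `𝟙` and `s`: so `s` is constant
  let q₀ : FreeGroup (surfaceGen g) ⧸ K.comap (proj g) := ((1 : FreeGroup (surfaceGen g)) : _)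
  have hconst : ∀ q, s q = s q₀ := by
    have hdep : ¬ LinearIndependent ℤ
        ![(⟨fun _ => (1 : ℤ), hone⟩ : LinearMap.ker Λ), ⟨s, hsker⟩] := by
      intro hli
      have := hli.fintype_card_le_finrank
      rw [Fintype.card_fin, hker1] at this
      omega
    rw [Fintype.not_linearIndependent_iff] at hdep
    obtain ⟨c, hc, i, hi⟩ := hdep
    rw [Fin.sum_univ_two] at hc
    have hc' : ∀ q, c 0 * 1 + c 1 * s q = 0 := fun q => by
      have := congrArg (fun w : LinearMap.ker Λ => (w : FreeGroup (surfaceGen g) ⧸ K.comap (proj g) → ℤ) q) hc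
      simpa using this
    by_cases hc1 : c 1 = 0
    · exfalso
      have hc0 : c 0 = 0 := by simpa [hc1] using hc' q₀
      fin_cases i <;> simp_all
    · intro q
      have := (hc' q).trans (hc' q₀).symm
      have h' : c 1 * s q = c 1 * s q₀ := by linarith
      exact mul_left_cancel₀ hc1 h'
  -- hence the class of `x` is the `k`-th power of the class of `ρ`, `k = s q₀`
  set k := s q₀ with hk
  have hsk : s = fun _ => k := funext fun q => hconst q
  have hρc : (QuotientGroup.mk ρ : K.comap (proj g) ⧸ ⁅(⊤ : Subgroup (K.comap (proj g))), N⁆) ∈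
      Subgroup.center _ := QuotientGroup.mk_mem_center_of_mem N hρN
  have hsumw : ∑ q, Additive.ofMul (wc q) =
      Additive.ofMul (⟨QuotientGroup.mk ρ, hρc⟩ : Subgroup.center _) := by
    have e1 : ∑ q, Additive.ofMul (wc q) = (l.map fun q => Additive.ofMul (wc q)).sum := by
      rw [(hperm.map _).sum_eq, Finset.sum_map_toList]
    have e2 : (l.map fun q => Additive.ofMul (wc q)).sum = Additive.ofMul ((l.map wc).prod) := by
      rw [ofMul_list_prod, List.map_map]; rfl
    have e3 : (l.map wc).prod = ⟨QuotientGroup.mk ρ, hρc⟩ := by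
      apply Subtype.ext
      change ((l.map wc).prod : K.comap (proj g) ⧸ ⁅(⊤ : Subgroup (K.comap (proj g))), N⁆) =
        QuotientGroup.mk' _ ρ
      rw [Subgroup.val_list_prod, List.map_map, hρ, map_list_prod, List.map_map]
      rfl
    rw [e1, e2, e3]
  have hclass : (⟨QuotientGroup.mk x, hxc⟩ : Subgroup.center
      (K.comap (proj g) ⧸ ⁅(⊤ : Subgroup (K.comap (proj g))), N⁆)) = ⟨QuotientGroup.mk ρ, hρc⟩ ^ k := by
    apply Additive.ofMul.injective
    rw [← hs', hsk, ofMul_zpow, ← Finset.smul_sum, hsumw]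
  have hxk : x⁻¹ * ρ ^ k ∈ ⁅(⊤ : Subgroup (K.comap (proj g))), N⁆ := by
    rw [← QuotientGroup.eq, QuotientGroup.mk_zpow]
    have hval := congrArg Subtype.val hclass
    rw [SubgroupClass.coe_zpow] at hval
    exact hval
  -- Hopf + the degree form on the `h`-side: `k = ±1`
  have hA := lift_comp_lift_surfaceRelator K e θ hθ θ' hθ'
  have hB : θ' (x⁻¹ * ρ ^ k) ∈ ⁅(⊤ : Subgroup (FreeGroup (surfaceGen h))), (proj h).ker⁆ :=
    map_lift_commutator_le K e θ' hθ' ⟨_, hxk, rfl⟩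
  have hρh : θ' ρ ∈ (proj h).ker := map_lift_ker_le K e θ' hθ' ⟨ρ, hρN, rfl⟩
  obtain ⟨m, hm⟩ := QuotientGroup.exists_mk_eq_mk_zpow_of_mem_normalClosure (surfaceRelator h)
    (x := θ' ρ) (by rw [← ker_proj_eq_normalClosure]; exact hρh)
  rw [← ker_proj_eq_normalClosure] at hm
  -- in `F_h ⧸ [F_h, R_h]`
  have hA' : (QuotientGroup.mk (θ' x) : FreeGroup (surfaceGen h) ⧸
      ⁅(⊤ : Subgroup (FreeGroup (surfaceGen h))), (proj h).ker⁆) = QuotientGroup.mk (surfaceRelator h) := by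
    rw [QuotientGroup.eq]; exact hA
  have hB' : (QuotientGroup.mk (θ' x) : FreeGroup (surfaceGen h) ⧸
      ⁅(⊤ : Subgroup (FreeGroup (surfaceGen h))), (proj h).ker⁆) =
      QuotientGroup.mk (surfaceRelator h ^ (m * k)) := by
    have hB2 : (θ' x)⁻¹ * θ' ρ ^ k ∈ ⁅(⊤ : Subgroup (FreeGroup (surfaceGen h))), (proj h).ker⁆ := by
      simpa only [map_mul, map_inv, map_zpow] using hB
    calc (QuotientGroup.mk (θ' x) : FreeGroup (surfaceGen h) ⧸
            ⁅(⊤ : Subgroup (FreeGroup (surfaceGen h))), (proj h).ker⁆)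
        = QuotientGroup.mk (θ' ρ ^ k) := QuotientGroup.eq.mpr hB2
      _ = (QuotientGroup.mk (θ' ρ)) ^ k := QuotientGroup.mk_zpow _ _ _
      _ = (QuotientGroup.mk (surfaceRelator h ^ m)) ^ k := by rw [hm]
      _ = QuotientGroup.mk (surfaceRelator h ^ (m * k)) := by
          rw [← QuotientGroup.mk_zpow, ← zpow_mul]
  have hj : (surfaceRelator h)⁻¹ * surfaceRelator h ^ (m * k) ∈
      ⁅(⊤ : Subgroup (FreeGroup (surfaceGen h))), (proj h).ker⁆ := by
    rw [← QuotientGroup.eq, ← hA', hB']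
  have hmk : m * k = 1 := zpow_eq_one_of_mem_commutator_ker hh1 hj
  rw [mul_comm] at hmk
  refine ⟨k, Int.eq_one_or_neg_one_of_mul_eq_one hmk, hxk⟩

/-- **Degree `± n`, pushed into the free group `F`.**  Under the same hypotheses, in `F` one has
`θ(r_h)⁻¹ · (∏_{q ∈ l} u_q⁻¹ r_g u_q)^{ε} ∈ [F, R]` for some `ε = ±1` — the form consumed by the
Heisenberg-form computation (`relatorDegree` / `omega` kill `[F, R]`).
[cite: Brown1982CohomologyGroups, III (9.5)(ii)] -/
theorem coe_lift_surfaceRelator_inv_mul_prod_zpow_mem (hg : 1 ≤ g) (K : Subgroup (SurfaceGroup g))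
    [K.FiniteIndex] (e : K ≃* SurfaceGroup h)
    (θ : FreeGroup (surfaceGen h) →* K.comap (proj g))
    (hθ : ∀ x, (proj g).subgroupComap K (θ x) = e.symm (proj h x))
    (θ' : K.comap (proj g) →* FreeGroup (surfaceGen h))
    (hθ' : ∀ y, proj h (θ' y) = e ((proj g).subgroupComap K y))
    (u : FreeGroup (surfaceGen g) ⧸ K.comap (proj g) → FreeGroup (surfaceGen g))
    (hu : ∀ q, (u q : FreeGroup (surfaceGen g) ⧸ K.comap (proj g)) = q)
    (l : List (FreeGroup (surfaceGen g) ⧸ K.comap (proj g))) (hl : ∀ q, q ∈ l) (hnd : l.Nodup)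
    {ι : Type} [Finite ι] (bE : FreeGroupBasis ι (K.comap (proj g)))
    (hι : Nat.card ι + K.index = K.index * (2 * g) + 1) (hh : h + K.index = K.index * g + 1) :
    ∃ ε : ℤ, (ε = 1 ∨ ε = -1) ∧
      ((θ (surfaceRelator h) : K.comap (proj g)) : FreeGroup (surfaceGen g))⁻¹ *
          (l.map fun q => (u q)⁻¹ * surfaceRelator g * u q).prod ^ ε ∈
        ⁅(⊤ : Subgroup (FreeGroup (surfaceGen g))), (proj g).ker⁆ := by
  obtain ⟨ε, hε, hmem⟩ := lift_surfaceRelator_inv_mul_prod_zpow_mem hg K e θ hθ θ' hθ' u hu l hl hnd bE hι hh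
  refine ⟨ε, hε, ?_⟩
  have hle : (⁅(⊤ : Subgroup (K.comap (proj g))), ((proj g).subgroupComap K).ker⁆).map
      (K.comap (proj g)).subtype ≤ ⁅(⊤ : Subgroup (FreeGroup (surfaceGen g))), (proj g).ker⁆ := by
    refine Subgroup.map_commutator_top_le _ ?_
    rintro _ ⟨y, hy, rfl⟩
    rw [SetLike.mem_coe, ker_subgroupComap_eq, mem_subgroupOf] at hy
    exact hy
  have := hle ⟨_, hmem, rfl⟩
  rw [Subgroup.coe_subtype, Subgroup.coe_mul, Subgroup.coe_inv, SubgroupClass.coe_zpow,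
    Subgroup.val_list_prod, List.map_map] at this
  exact this

end SurfaceGroup

end Literature.Topology.FourManifolds
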